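import Summits.Ventures.CertifiedManyBodySolver.Rows.DopedTLCorr

/-!
# Thermodynamic-limit correlator rows over a PARAMETER BOX of the `t–t'` square lattice (M3′ BOX cells):
# energy-cap FUNCTION on the box, rational slot, verbatim binder shape of the point rows

HONEST FRAMING: first certified bounds; not a superconductivity verdict; every number certified or
labelled float. NOTHING IS ASSERTED HERE: every bound-valued statement is a `def … : Prop` or takes row
predicates as hypotheses.

WHAT THIS FILE IS (cell hubbard-algo, seat hubbard-box-eng-3 = the box-dual certificate format `boxdual/0`
and its exact reader; stage S2 "points → boxes" of the Hubbard material oracle, D-0096/D-0097). The point rows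
of `Rows/DopedTLCorr.lean` §B (`SquareTTPrimeCorrLowerRow tp U n u r Λ X`: for every torus limit of unit
sector ground states at ONE coupling point `(t', U, n)`, GIVEN `energyDensityTT' 1 t' U n ≤ u`, `r ≤ Re ω(X)`)
have a constant energy slot `u : ℚ`. A BOX WORD — the sentence a `boxdual/0` bundle certifies over a cell
`C = Set.Icc lo hi` of parameter space in the router's coordinate order `θ = (U, t', n)` (`θ 0 = U`,
`θ 1 = t'`, `θ 2 = n`, as in `forall_groundStates_le_of_gridCells₃` of
`Literature/MathematicalPhysics/QuantumLattice/HubbardTTPrimeBoxWordCovering`) — is the same sentence at EVERY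
point of the cell, with the energy hypothesis `energyDensityTT' 1 (θ 1) (θ 0) (θ 2) ≤ cap θ` for a cap
FUNCTION `cap : (Fin 3 → ℝ) → ℝ` (the bundle's declared cap row: an affine plane on a `(U, t')` cell, the
density chord of two layer planes on a density-extent cell — `BOXDUAL-FORMAT.md` §1, §11, §16; the cap's
validity `e₀ ≤ cap` on the cell is the producer's cited device and is NOT part of the row). This file types

* §C the BOX ROW PREDICATES `SquareTTPrimeCorrLowerBoxRow / UpperBoxRow / OrbitLowerBoxRow lo hi cap r …`
  (+ the docc cells), binder lists VERBATIM those of §B with `(tp, U, n) := (θ 1, θ 0, θ 2)`;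
* the solver-free edges: upper ⟷ lower on `−X`; monotonicity in the slot, in the cap (a row SURVIVES any
  TIGHTER cap function — the logical half of the cap-override sentence of `BOXDUAL-FORMAT.md` §16) and in the
  box (restriction to a sub-box); the POINT ROW at any point of the box whose rational energy slot lies
  below the cap there (`…BoxRow.at_point`); the COVERING rule (a box covered by finitely many certified boxes
  carries the weakest slot — the union word of a grid read, `boxdual` `run_grid` SUMMARY "UNION"); the
  UNCONDITIONAL shape once the cap is discharged on the box (`…BoxRow.uncond`, literally the per-cell
  hypothesis `hcell` of `forall_groundStates_le_of_gridCells₃`); and NON-VACUITY ⇒ slot consistency.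

Rows are instantiated only under `Certificates/` (claim nodes of `boxdual/0` words of record). No `sorry`,
no new axiom, no named fact, no number.
-/

noncomputable section

namespace Summit.Ventures.CertifiedManyBodySolver

open Literature.MathematicalPhysics.QuantumLattice
open Matrix HubbardWave0 Literature.Probability.LatticeModels ThermodynamicLimit Filter Topology
open scoped BigOperators

/-! ## §C  BOX rows of the `t–t'` square lattice (`t = 1`; box coordinates `θ = (U, t', n)`) -/

section SquareBox

/-- §C (LOWER form). Box `Set.Icc lo hi` of couplings `θ = (U, t', n)` (`θ 0 = U`, `θ 1 = t'`, `θ 2 = n`),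
energy-cap function `cap` on the box: for EVERY `θ` of the box, every torus limit `ω` of unit ground states
`ψ` of the sectors `(rectN n L_j, S^z = 0)` of `hubbardTorusTT' L_j 1 t' U` along `L_j → ∞`, GIVEN
`energyDensityTT' 1 t' U n ≤ cap θ`, the window observable `X` on the finite support `Λ` has `r ≤ Re ω(X)`.
Per point this is `SquareTTPrimeCorrLowerRow` with the rational energy slot replaced by `cap θ`. -/
def SquareTTPrimeCorrLowerBoxRow (lo hi : Fin 3 → ℝ) (cap : (Fin 3 → ℝ) → ℝ) (r : ℚ)
    (Λ : Finset (Site 2)) (X : FermionOp Λ) : Prop :=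
  ∀ θ ∈ Set.Icc lo hi, ∀ (ω : InfVolFermionState 2) (Ls : ℕ → ℕ) (ψ : ∀ L, Fock (Orb (FermionTorus 2 L))),
    Tendsto Ls atTop atTop →
    (∀ j, IsGroundStateInSector (hubbardTorusTT' (Ls j) 1 (θ 1) (θ 0)) (rectN (θ 2) (Ls j)) 0 (ψ (Ls j))) →
    (∀ j, star (ψ (Ls j)) ⬝ᵥ ψ (Ls j) = 1) → ω.IsTorusLimitOf ψ Ls →
    energyDensityTT' 1 (θ 1) (θ 0) (θ 2) ≤ cap θ →
    ((r : ℚ) : ℝ) ≤ (ω.expect Λ X).re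

/-- §C (UPPER form): same box, state class and energy hypothesis, conclusion `Re ω(X) ≤ r`. -/
def SquareTTPrimeCorrUpperBoxRow (lo hi : Fin 3 → ℝ) (cap : (Fin 3 → ℝ) → ℝ) (r : ℚ)
    (Λ : Finset (Site 2)) (X : FermionOp Λ) : Prop :=
  ∀ θ ∈ Set.Icc lo hi, ∀ (ω : InfVolFermionState 2) (Ls : ℕ → ℕ) (ψ : ∀ L, Fock (Orb (FermionTorus 2 L))),
    Tendsto Ls atTop atTop →
    (∀ j, IsGroundStateInSector (hubbardTorusTT' (Ls j) 1 (θ 1) (θ 0)) (rectN (θ 2) (Ls j)) 0 (ψ (Ls j))) →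
    (∀ j, star (ψ (Ls j)) ⬝ᵥ ψ (Ls j) = 1) → ω.IsTorusLimitOf ψ Ls →
    energyDensityTT' 1 (θ 1) (θ 0) (θ 2) ≤ cap θ →
    (ω.expect Λ X).re ≤ ((r : ℚ) : ℝ)

/-- §C (`D₄`-ORBIT-MEAN form, the honest conclusion of a point-group-reduced certificate): same box, state
class and energy hypothesis, conclusion `r ≤ |S|⁻¹ Σ_{γ ∈ S} Re ω_{γΛ}(Γ(d4Emb γ 0) X)`. -/
def SquareTTPrimeCorrOrbitLowerBoxRow (lo hi : Fin 3 → ℝ) (cap : (Fin 3 → ℝ) → ℝ) (r : ℚ)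
    (S : Finset (DihedralGroup 4)) (Λ : Finset (Site 2)) (X : FermionOp Λ) : Prop :=
  ∀ θ ∈ Set.Icc lo hi, ∀ (ω : InfVolFermionState 2) (Ls : ℕ → ℕ) (ψ : ∀ L, Fock (Orb (FermionTorus 2 L))),
    Tendsto Ls atTop atTop →
    (∀ j, IsGroundStateInSector (hubbardTorusTT' (Ls j) 1 (θ 1) (θ 0)) (rectN (θ 2) (Ls j)) 0 (ψ (Ls j))) →
    (∀ j, star (ψ (Ls j)) ⬝ᵥ ψ (Ls j) = 1) → ω.IsTorusLimitOf ψ Ls →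
    energyDensityTT' 1 (θ 1) (θ 0) (θ 2) ≤ cap θ →
    ((r : ℚ) : ℝ) ≤ (S.card : ℝ)⁻¹ *
      ∑ g ∈ S, (ω.expect (d4ShiftSet g 0 Λ) (fermionEmbed (PolySite.d4Emb g 0 Λ) X)).re

/-- M3′ BOX double-occupancy LOWER cell: `r ≤ Re ω(n_{0↑}n_{0↓})` on the box given `e₀ ≤ cap`. -/
def SquareTTPrimeDoccLowerBoxRow (lo hi : Fin 3 → ℝ) (cap : (Fin 3 → ℝ) → ℝ) (r : ℚ) : Prop :=
  SquareTTPrimeCorrLowerBoxRow lo hi cap r {0} (doccAt0 2)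

/-- M3′ BOX double-occupancy UPPER cell: `Re ω(n_{0↑}n_{0↓}) ≤ r` on the box given `e₀ ≤ cap`. -/
def SquareTTPrimeDoccUpperBoxRow (lo hi : Fin 3 → ℝ) (cap : (Fin 3 → ℝ) → ℝ) (r : ℚ) : Prop :=
  SquareTTPrimeCorrUpperBoxRow lo hi cap r {0} (doccAt0 2)

variable {lo hi lo' hi' : Fin 3 → ℝ} {cap cap' : (Fin 3 → ℝ) → ℝ} {u r r' : ℚ}
  {Λ : Finset (Site 2)} {X : FermionOp Λ}

/-- UPPER box rows from LOWER box rows on the negated objective: `−r ≤ Re ω(−X)` is `Re ω(X) ≤ r`. -/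
theorem SquareTTPrimeCorrUpperBoxRow.of_lower_neg (h : SquareTTPrimeCorrLowerBoxRow lo hi cap (-r) Λ (-X)) :
    SquareTTPrimeCorrUpperBoxRow lo hi cap r Λ X := by
  intro θ hθ ω Ls ψ hLs hψ hψ1 hω hu
  have hh := h θ hθ ω Ls ψ hLs hψ hψ1 hω hu
  rw [map_neg, Complex.neg_re] at hh
  push_cast at hh
  linarith

/-- LOWER box rows from UPPER box rows on the negated objective. -/
theorem SquareTTPrimeCorrLowerBoxRow.of_upper_neg (h : SquareTTPrimeCorrUpperBoxRow lo hi cap (-r) Λ (-X)) :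
    SquareTTPrimeCorrLowerBoxRow lo hi cap r Λ X := by
  intro θ hθ ω Ls ψ hLs hψ hψ1 hω hu
  have hh := h θ hθ ω Ls ψ hLs hψ hψ1 hω hu
  rw [map_neg, Complex.neg_re] at hh
  push_cast at hh
  linarith

/-- MONOTONICITY of a lower box row: it survives a SUB-BOX (`lo ≤ lo'`, `hi' ≤ hi`), any TIGHTER cap function
on that sub-box (`cap' ≤ cap` there — fewer states qualify: the logical half of the cap-override sentence of
`BOXDUAL-FORMAT.md` §16) and a SMALLER slot `r' ≤ r`. -/
theorem SquareTTPrimeCorrLowerBoxRow.mono (h : SquareTTPrimeCorrLowerBoxRow lo hi cap r Λ X)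
    (hlo : lo ≤ lo') (hhi : hi' ≤ hi) (hcap : ∀ θ ∈ Set.Icc lo' hi', cap' θ ≤ cap θ) (hr : r' ≤ r) :
    SquareTTPrimeCorrLowerBoxRow lo' hi' cap' r' Λ X := by
  intro θ hθ ω Ls ψ hLs hψ hψ1 hω hu
  have hθ' : θ ∈ Set.Icc lo hi := ⟨hlo.trans hθ.1, hθ.2.trans hhi⟩
  have hh := h θ hθ' ω Ls ψ hLs hψ hψ1 hω (hu.trans (hcap θ hθ))
  exact le_trans (by exact_mod_cast hr) hh

/-- MONOTONICITY of an upper box row: sub-box, tighter cap, LARGER slot `r ≤ r'`. -/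
theorem SquareTTPrimeCorrUpperBoxRow.mono (h : SquareTTPrimeCorrUpperBoxRow lo hi cap r Λ X)
    (hlo : lo ≤ lo') (hhi : hi' ≤ hi) (hcap : ∀ θ ∈ Set.Icc lo' hi', cap' θ ≤ cap θ) (hr : r ≤ r') :
    SquareTTPrimeCorrUpperBoxRow lo' hi' cap' r' Λ X := by
  intro θ hθ ω Ls ψ hLs hψ hψ1 hω hu
  have hθ' : θ ∈ Set.Icc lo hi := ⟨hlo.trans hθ.1, hθ.2.trans hhi⟩
  have hh := h θ hθ' ω Ls ψ hLs hψ hψ1 hω (hu.trans (hcap θ hθ))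
  exact hh.trans (by exact_mod_cast hr)

/-- The POINT ROW at any point `θ` of the box whose rational energy slot `u` lies below the cap there
(`u ≤ cap θ`): `SquareTTPrimeCorrLowerRow (θ 1) (θ 0) (θ 2) u r Λ X` (§B; at `θ = (8, tp, 7/8)` an
`M3CorrLowerRow tp u r Λ X`). -/
theorem SquareTTPrimeCorrLowerBoxRow.at_point (h : SquareTTPrimeCorrLowerBoxRow lo hi cap r Λ X)
    {θ : Fin 3 → ℝ} (hθ : θ ∈ Set.Icc lo hi) (hu : ((u : ℚ) : ℝ) ≤ cap θ) :
    SquareTTPrimeCorrLowerRow (θ 1) (θ 0) (θ 2) u r Λ X :=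
  fun ω Ls ψ hLs hψ hψ1 hω he => h θ hθ ω Ls ψ hLs hψ hψ1 hω (he.trans hu)

/-- The point UPPER row at any point of the box whose rational energy slot lies below the cap there. -/
theorem SquareTTPrimeCorrUpperBoxRow.at_point (h : SquareTTPrimeCorrUpperBoxRow lo hi cap r Λ X)
    {θ : Fin 3 → ℝ} (hθ : θ ∈ Set.Icc lo hi) (hu : ((u : ℚ) : ℝ) ≤ cap θ) :
    SquareTTPrimeCorrUpperRow (θ 1) (θ 0) (θ 2) u r Λ X :=
  fun ω Ls ψ hLs hψ hψ1 hω he => h θ hθ ω Ls ψ hLs hψ hψ1 hω (he.trans hu)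

/-- Conversely a box row FROM point rows: if at every point of the box some rational slot `u θ ≥ cap θ`
carries the point lower row with the common slot `r`, the box row holds (how a family of point certificates
under a uniform cap device would be read; not the `boxdual/0` mechanism, which needs no interior solve). -/
theorem SquareTTPrimeCorrLowerBoxRow.of_forall_points (uθ : (Fin 3 → ℝ) → ℚ)
    (hcap : ∀ θ ∈ Set.Icc lo hi, cap θ ≤ ((uθ θ : ℚ) : ℝ))
    (h : ∀ θ ∈ Set.Icc lo hi, SquareTTPrimeCorrLowerRow (θ 1) (θ 0) (θ 2) (uθ θ) r Λ X) :
    SquareTTPrimeCorrLowerBoxRow lo hi cap r Λ X :=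
  fun θ hθ ω Ls ψ hLs hψ hψ1 hω he => h θ hθ ω Ls ψ hLs hψ hψ1 hω (he.trans (hcap θ hθ))

/-- COVERING RULE (the UNION word of a grid read; Neumaier, *Acta Numerica* 13 (2004) §12 (12.2)–(12.3):
a bound certified on every sub-box of a cover is a bound on the box, the weakest one). Finitely many
certified boxes `Set.Icc (los i) (his i)` with caps `caps i` and slots `rs i`; every point `θ` of the target
box lies in one of them whose cap dominates the target cap at `θ` (`cap θ ≤ caps i θ` — e.g. equal: the
cells of one grid product carry one continuous cap); then any slot `r ≤ rs i` (all `i`) is a lower box row on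
the target box. -/
theorem SquareTTPrimeCorrLowerBoxRow.of_cover {ι : Type*} (I : Finset ι) (los his : ι → Fin 3 → ℝ)
    (caps : ι → (Fin 3 → ℝ) → ℝ) (rs : ι → ℚ)
    (hrows : ∀ i ∈ I, SquareTTPrimeCorrLowerBoxRow (los i) (his i) (caps i) (rs i) Λ X)
    (hcov : ∀ θ ∈ Set.Icc lo hi, ∃ i ∈ I, θ ∈ Set.Icc (los i) (his i) ∧ cap θ ≤ caps i θ)
    (hr : ∀ i ∈ I, r ≤ rs i) : SquareTTPrimeCorrLowerBoxRow lo hi cap r Λ X := by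
  intro θ hθ ω Ls ψ hLs hψ hψ1 hω hu
  obtain ⟨i, hi, hθi, hci⟩ := hcov θ hθ
  have hh := hrows i hi θ hθi ω Ls ψ hLs hψ hψ1 hω (hu.trans hci)
  exact le_trans (by exact_mod_cast hr i hi) hh

/-- COVERING RULE for upper box rows (slot `rs i ≤ r` for all `i`). -/
theorem SquareTTPrimeCorrUpperBoxRow.of_cover {ι : Type*} (I : Finset ι) (los his : ι → Fin 3 → ℝ)
    (caps : ι → (Fin 3 → ℝ) → ℝ) (rs : ι → ℚ)
    (hrows : ∀ i ∈ I, SquareTTPrimeCorrUpperBoxRow (los i) (his i) (caps i) (rs i) Λ X)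
    (hcov : ∀ θ ∈ Set.Icc lo hi, ∃ i ∈ I, θ ∈ Set.Icc (los i) (his i) ∧ cap θ ≤ caps i θ)
    (hr : ∀ i ∈ I, rs i ≤ r) : SquareTTPrimeCorrUpperBoxRow lo hi cap r Λ X := by
  intro θ hθ ω Ls ψ hLs hψ hψ1 hω hu
  obtain ⟨i, hi, hθi, hci⟩ := hcov θ hθ
  have hh := hrows i hi θ hθi ω Ls ψ hLs hψ hψ1 hω (hu.trans hci)
  exact hh.trans (by exact_mod_cast hr i hi)

/-- UNCONDITIONAL SHAPE: once the cap is DISCHARGED on the box (`e₀(θ) ≤ cap θ` for every `θ` of the box —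
the producer's transport device: tangent planes / pyramid faces of a concave `e₀(·, t', U)`, density chords of a
convex `e₀(n)`, `energyDensityTT'_le_densityAffineCap_Icc₃`, …), a lower box row bounds `Re ω(X)` for EVERY
state of the class at EVERY point of the box — literally the per-cell hypothesis `hcell` of
`forall_groundStates_le_of_gridCells₃` (with `obs ω = Re ω(X)`, `Fl = r`), so box rows feed the router's
box-⊂-union-of-cells bookkeeping directly. -/
theorem SquareTTPrimeCorrLowerBoxRow.uncond (h : SquareTTPrimeCorrLowerBoxRow lo hi cap r Λ X)
    (hcap : ∀ θ ∈ Set.Icc lo hi, energyDensityTT' 1 (θ 1) (θ 0) (θ 2) ≤ cap θ) :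
    ∀ θ ∈ Set.Icc lo hi, ∀ (ω : InfVolFermionState 2) (Ls : ℕ → ℕ) (ψ : ∀ L, Fock (Orb (FermionTorus 2 L))),
      Tendsto Ls atTop atTop →
      (∀ j, IsGroundStateInSector (hubbardTorusTT' (Ls j) 1 (θ 1) (θ 0)) (rectN (θ 2) (Ls j)) 0 (ψ (Ls j))) →
      (∀ j, star (ψ (Ls j)) ⬝ᵥ ψ (Ls j) = 1) → ω.IsTorusLimitOf ψ Ls →
      ((r : ℚ) : ℝ) ≤ (ω.expect Λ X).re :=
  fun θ hθ ω Ls ψ hLs hψ hψ1 hω => h θ hθ ω Ls ψ hLs hψ hψ1 hω (hcap θ hθ)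

/-- UNCONDITIONAL SHAPE of an upper box row once the cap is discharged on the box. -/
theorem SquareTTPrimeCorrUpperBoxRow.uncond (h : SquareTTPrimeCorrUpperBoxRow lo hi cap r Λ X)
    (hcap : ∀ θ ∈ Set.Icc lo hi, energyDensityTT' 1 (θ 1) (θ 0) (θ 2) ≤ cap θ) :
    ∀ θ ∈ Set.Icc lo hi, ∀ (ω : InfVolFermionState 2) (Ls : ℕ → ℕ) (ψ : ∀ L, Fock (Orb (FermionTorus 2 L))),
      Tendsto Ls atTop atTop →
      (∀ j, IsGroundStateInSector (hubbardTorusTT' (Ls j) 1 (θ 1) (θ 0)) (rectN (θ 2) (Ls j)) 0 (ψ (Ls j))) →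
      (∀ j, star (ψ (Ls j)) ⬝ᵥ ψ (Ls j) = 1) → ω.IsTorusLimitOf ψ Ls →
      (ω.expect Λ X).re ≤ ((r : ℚ) : ℝ) :=
  fun θ hθ ω Ls ψ hLs hψ hψ1 hω => h θ hθ ω Ls ψ hLs hψ hψ1 hω (hcap θ hθ)

/-- The `D₄`-orbit box row at the TRIVIAL label set `S = {1}` IS the plain lower box row
(`InfVolFermionState.expect_fermionEmbed_d4Emb_one_zero`). -/
theorem squareTTPrimeCorrOrbitLowerBoxRow_singleton_one_iff :
    SquareTTPrimeCorrOrbitLowerBoxRow lo hi cap r {1} Λ X ↔ SquareTTPrimeCorrLowerBoxRow lo hi cap r Λ X := by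
  unfold SquareTTPrimeCorrOrbitLowerBoxRow SquareTTPrimeCorrLowerBoxRow
  simp only [Finset.sum_singleton, Finset.card_singleton, Nat.cast_one, inv_one, one_mul,
    InfVolFermionState.expect_fermionEmbed_d4Emb_one_zero]

/-- NON-VACUITY ⇒ CONSISTENCY OF THE SLOTS on a box: if some point `θ` of the box has a density in `[0, 2]`
and satisfies the energy hypothesis (`e₀(θ) ≤ cap θ` — automatic once the cap is a certified majorant),
the state class at `θ` is inhabited (`exists_isTorusLimitOf_sectorGroundState_TT'`), so a typed LOWER box slot
never exceeds a typed UPPER box slot on the same objective. -/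
theorem SquareTTPrimeCorrLowerBoxRow.le_of_upperBoxRow (hl : SquareTTPrimeCorrLowerBoxRow lo hi cap r Λ X)
    (hu' : SquareTTPrimeCorrUpperBoxRow lo hi cap r' Λ X) {θ : Fin 3 → ℝ} (hθ : θ ∈ Set.Icc lo hi)
    (hn0 : 0 ≤ θ 2) (hn2 : θ 2 ≤ 2) (he : energyDensityTT' 1 (θ 1) (θ 0) (θ 2) ≤ cap θ) : r ≤ r' := by
  obtain ⟨ψ, φ, ω, hφ, hψ, hψ1, hω, -, -, -⟩ :=
    exists_isTorusLimitOf_sectorGroundState_TT' 1 (θ 1) (θ 0) hn0 hn2 (Ls := id) tendsto_id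
  have hLs : Tendsto (id ∘ φ) atTop atTop := hφ.tendsto_atTop
  have h1 := hl θ hθ ω (id ∘ φ) ψ hLs (fun j => hψ _) (fun j => hψ1 _) hω he
  have h2 := hu' θ hθ ω (id ∘ φ) ψ hLs (fun j => hψ _) (fun j => hψ1 _) hω he
  exact_mod_cast h1.trans h2

/-! ### Edges of the `D₄`-ORBIT box rows (appended 2026-08-27 by hubbard-box-eng-3 g4: the honest cell of a point-group-reduced
certificate on a non-invariant word — e.g. the kinetic word `kinWord` of `Observables/KineticWordD4.lean`, whose full-orbit mean IS the
kinetic energy density of a translation-invariant state) -/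

/-- MONOTONICITY of an orbit lower box row: sub-box, tighter cap, smaller slot (same label set, support and word). -/
theorem SquareTTPrimeCorrOrbitLowerBoxRow.mono {S : Finset (DihedralGroup 4)}
    (h : SquareTTPrimeCorrOrbitLowerBoxRow lo hi cap r S Λ X)
    (hlo : lo ≤ lo') (hhi : hi' ≤ hi) (hcap : ∀ θ ∈ Set.Icc lo' hi', cap' θ ≤ cap θ) (hr : r' ≤ r) :
    SquareTTPrimeCorrOrbitLowerBoxRow lo' hi' cap' r' S Λ X := by
  intro θ hθ ω Ls ψ hLs hψ hψ1 hω hu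
  have hθ' : θ ∈ Set.Icc lo hi := ⟨hlo.trans hθ.1, hθ.2.trans hhi⟩
  have hh := h θ hθ' ω Ls ψ hLs hψ hψ1 hω (hu.trans (hcap θ hθ))
  exact le_trans (by exact_mod_cast hr) hh

/-- The POINT orbit row (§B `SquareTTPrimeCorrOrbitLowerRow`) at any point of the box whose rational energy slot lies below the
cap there. -/
theorem SquareTTPrimeCorrOrbitLowerBoxRow.at_point {S : Finset (DihedralGroup 4)}
    (h : SquareTTPrimeCorrOrbitLowerBoxRow lo hi cap r S Λ X)
    {θ : Fin 3 → ℝ} (hθ : θ ∈ Set.Icc lo hi) (hu : ((u : ℚ) : ℝ) ≤ cap θ) :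
    SquareTTPrimeCorrOrbitLowerRow (θ 1) (θ 0) (θ 2) u r S Λ X :=
  fun ω Ls ψ hLs hψ hψ1 hω he => h θ hθ ω Ls ψ hLs hψ hψ1 hω (he.trans hu)

/-- COVERING RULE for orbit lower box rows (the union word of a grid read of a `D₄`-class word; slot `r ≤ rs i` for all `i`). -/
theorem SquareTTPrimeCorrOrbitLowerBoxRow.of_cover {S : Finset (DihedralGroup 4)} {ι : Type*} (I : Finset ι)
    (los his : ι → Fin 3 → ℝ) (caps : ι → (Fin 3 → ℝ) → ℝ) (rs : ι → ℚ)
    (hrows : ∀ i ∈ I, SquareTTPrimeCorrOrbitLowerBoxRow (los i) (his i) (caps i) (rs i) S Λ X)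
    (hcov : ∀ θ ∈ Set.Icc lo hi, ∃ i ∈ I, θ ∈ Set.Icc (los i) (his i) ∧ cap θ ≤ caps i θ)
    (hr : ∀ i ∈ I, r ≤ rs i) : SquareTTPrimeCorrOrbitLowerBoxRow lo hi cap r S Λ X := by
  intro θ hθ ω Ls ψ hLs hψ hψ1 hω hu
  obtain ⟨i, hi, hθi, hci⟩ := hcov θ hθ
  have hh := hrows i hi θ hθi ω Ls ψ hLs hψ hψ1 hω (hu.trans hci)
  exact le_trans (by exact_mod_cast hr i hi) hh

/-- UNCONDITIONAL SHAPE of an orbit lower box row once the cap is discharged on the box: for every state of the class at every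
point of the box, `r ≤ |S|⁻¹ Σ_{γ ∈ S} Re ω_{γΛ}(Γ(d4Emb γ 0) X)`. -/
theorem SquareTTPrimeCorrOrbitLowerBoxRow.uncond {S : Finset (DihedralGroup 4)}
    (h : SquareTTPrimeCorrOrbitLowerBoxRow lo hi cap r S Λ X)
    (hcap : ∀ θ ∈ Set.Icc lo hi, energyDensityTT' 1 (θ 1) (θ 0) (θ 2) ≤ cap θ) :
    ∀ θ ∈ Set.Icc lo hi, ∀ (ω : InfVolFermionState 2) (Ls : ℕ → ℕ) (ψ : ∀ L, Fock (Orb (FermionTorus 2 L))),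
      Tendsto Ls atTop atTop →
      (∀ j, IsGroundStateInSector (hubbardTorusTT' (Ls j) 1 (θ 1) (θ 0)) (rectN (θ 2) (Ls j)) 0 (ψ (Ls j))) →
      (∀ j, star (ψ (Ls j)) ⬝ᵥ ψ (Ls j) = 1) → ω.IsTorusLimitOf ψ Ls →
      ((r : ℚ) : ℝ) ≤ (S.card : ℝ)⁻¹ *
        ∑ g ∈ S, (ω.expect (d4ShiftSet g 0 Λ) (fermionEmbed (PolySite.d4Emb g 0 Λ) X)).re :=
  fun θ hθ ω Ls ψ hLs hψ hψ1 hω => h θ hθ ω Ls ψ hLs hψ hψ1 hω (hcap θ hθ)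

/-- An orbit box row for an `ω`-INVARIANT family of rotated copies is the plain box row (the invariance of every state of the class
on each `Γ(d4Emb γ 0) X`, `γ ∈ S`, as an explicit hypothesis). -/
theorem SquareTTPrimeCorrOrbitLowerBoxRow.lowerBoxRow_of_invariant {S : Finset (DihedralGroup 4)}
    (h : SquareTTPrimeCorrOrbitLowerBoxRow lo hi cap r S Λ X) (hS : S.Nonempty)
    (hinv : ∀ θ ∈ Set.Icc lo hi, ∀ (ω : InfVolFermionState 2) (Ls : ℕ → ℕ) (ψ : ∀ L, Fock (Orb (FermionTorus 2 L))),
      Tendsto Ls atTop atTop →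
      (∀ j, IsGroundStateInSector (hubbardTorusTT' (Ls j) 1 (θ 1) (θ 0)) (rectN (θ 2) (Ls j)) 0 (ψ (Ls j))) →
      (∀ j, star (ψ (Ls j)) ⬝ᵥ ψ (Ls j) = 1) → ω.IsTorusLimitOf ψ Ls →
      ∀ g ∈ S, ω.expect (d4ShiftSet g 0 Λ) (fermionEmbed (PolySite.d4Emb g 0 Λ) X) = ω.expect Λ X) :
    SquareTTPrimeCorrLowerBoxRow lo hi cap r Λ X := by
  intro θ hθ ω Ls ψ hLs hψ hψ1 hω hu
  have hh := h θ hθ ω Ls ψ hLs hψ hψ1 hω hu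
  have hsum : ∑ g ∈ S, (ω.expect (d4ShiftSet g 0 Λ) (fermionEmbed (PolySite.d4Emb g 0 Λ) X)).re =
      ∑ g ∈ S, (ω.expect Λ X).re :=
    Finset.sum_congr rfl fun g hg => by rw [hinv θ hθ ω Ls ψ hLs hψ hψ1 hω g hg]
  have hc : (S.card : ℝ) ≠ 0 := by exact_mod_cast hS.card_pos.ne'
  rwa [hsum, Finset.sum_const, nsmul_eq_mul, ← mul_assoc, inv_mul_cancel₀ hc, one_mul] at hh

end SquareBox

end Summit.Ventures.CertifiedManyBodySolver

end
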